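import Summits.QuantumFields.YangMills.Theorems.BalabanUVNodesPortS1JacOffWrap
import Summits.QuantumFields.YangMills.Theorems.BalabanUVNodesPortS1JacobianGerm
import Summits.QuantumFields.YangMills.Theorems.BalabanUVNodesPortS1HalvesJacDefs
import Summits.QuantumFields.YangMills.Theorems.BalabanUVNodesPortS1CfgPiecesW
import Literature.MathematicalPhysics.QuantumFieldTheory.Balaban1983to89.B15Claim189UnitTestAtRecord
import Literature.MathematicalPhysics.QuantumFieldTheory.Balaban1983to89.T3DescentFibreTower

/-!
# NODE O port PT-A — ROW (f′)-W OF `stub_LZjac`: THE WRAP-AWARE PAIR IDENTITY FOR THE δ-JACOBIAN BRACKET — near `B = 0`, `phiLZjac n B = Σ_X (X ∈ wrap ? E_T(X, pair|_X) : Ψ_jac(X̂)(pair|_X ∘ π))`,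
# i.e. `(ΨjacRaw F Mc k).RepresentsW F a₀ ε₂₉ Mc k (jacTorusPieces F Mc k) (phiLZjac F Mc a₀ ε₂₉ k)` from ⁸'s TokE + TokP9-reg token shapes

Cell `ym-nodeO-ideate`, porter seat `ymgap-nodeO-port-PTA-1` (gen 6); `--supports stmt-QuantumFields-27930` (helper); ✓ `…JacPiecesDefs`, `…JacCoverDeriv`, `…JacIntGaugeBlock`, `…JacTorusRows`,
`…JacOffWrap`; gen 5 ✓ `…JacobianGerm` (`eventually_jacFactorC_portVkAx`), ✓ `…PathLetter` (`eventually_portVkAx_eq_axialize_iter`, `eventually_small_portVkAx`), ✓ `…HalvesJacDefs` (`phiLZjac`),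
✓ `…CfgPiecesW` (`pairCutTorusAt_eq`, `pairCutAt_eq_pullPair_pairCutTorusAt`); tree ✓ `B15AveragingHolomorphic.coeField_avgFamily_eq_iterMh`, `BlockAxialRepresentative.axialize_def`,
`B15Claim189UnitTestAtRecord.iter_avOfRecord_one`, `T3DescentFibreTower.small_one`.  [I] = [Balaban1987RG1], [15] = [Balaban1985Variational].
THE GERM.  Near `B = 0`: `jacFactor B c` (= `log|det A₁(c)(V^{(k)}_{ax}(W_B))|`, ✓p812199) `= jacFactorC c ↑V_B` (✓p812545) `= jacFactorCt c ↑V_B` (in the guard the componentwise∕projected block is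
the block: `fderiv_apply`, `trace_jacResponse_eq_zero`) `= jacFactorCt c ↑(Ū^k U_B)` (`V_B = axialize(Ū^k U_B)` is a gauge transform; `jacFactorCt_gauge` for EVERY field) `= J_T(c, ↑U_B)`
(`↑Ū^k = iterMh k ↑` under the guard below `k`, which holds near `0` by continuity at `U_0 = 1`).  Then `phiLZjac n B = −Σ_c (J_T(c, ↑U_B) − J_T(c, 1)) = Σ_X E_T(X, φ_B)` (fibres of `c ↦ X(c)`),
`E_T(X, φ_B) = E_T(X, φ_B|_X)` (locality ✓ `jacPieceT_congr_of_agreeOnSet`) `= Ψ_jac(X̂_K(X))(φ_B|_X ∘ π)` off the wrap class (✓ `ΨjacRaw_intCubes_pullPair`).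
* §1 `jacBlockCt_coeField_eq_jacBlockC`, `jacFactorCt_coeField_eq_jacFactorC`, ★ `jacFactorCt_gauge` (torus, every field), `coeField_gaugeAct`.
* §2 `eventually_smallBelow_recordBgField`, ★★★ `eventually_jacFactor_eq_jacTorus`.
* §3 `agreeOnSet_pairCutTorusAt`, ★★★ `representsW_phiLZjac`.

HONEST FRAMING.  Bookkeeping over the tree's own theorems and ⁸'s token SHAPES (hypotheses); NOTHING of Bałaban's estimates asserted, ported or discharged; rows (a)(b) remain the displayed
`JacRowsAB`; `stub_LZjac` OPEN; 27930 OPEN · no claim; K0⁷∕K-Ax OPEN; NODE O 0∕1; COUNT 8∕28 · K 1∕4 UNMOVED; finite `𝕋⁴_{L^K}` at fixed ε — NOT continuum ∕ OS ∕ Clay; **the Yang–Mills mass gap is NOT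
proved by any of this.**  No `sorry`, no `def`, no `instance`, no `notation`; standard axioms.
-/

noncomputable section

open scoped BigOperators Matrix.Norms.L2Operator Topology

namespace Summit.QuantumFields.YangMills.Theorems.BalabanUVNodesPortS1

open Summit.QuantumFields.YangMills.Theorems.K0RecordFormatNames
open Literature.MathematicalPhysics.QuantumFieldTheory.Balaban1983to89
open Literature.MathematicalPhysics.QuantumFieldTheory.Balaban1983to89.Node00
open Literature.MathematicalPhysics.QuantumFieldTheory.Balaban1983to89.T4Continuum (T4Family Letter LStep)
open Literature.MathematicalPhysics.QuantumFieldTheory.Balaban1983to89.B7Prop1Explicit (e e_apply)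
open Literature.MathematicalPhysics.QuantumFieldTheory.Balaban1983to89.BlockAveraging (Idx Small)
open Literature.MathematicalPhysics.QuantumFieldTheory.Balaban1983to89.BlockAveragingHaarAC (centralBond)
open Literature.MathematicalPhysics.QuantumFieldTheory.Balaban1983to89.ExpMeanLog (expMeanLogSU)
open Literature.MathematicalPhysics.QuantumFieldTheory.Balaban1983to89.B15AveragingHolomorphic
open Literature.MathematicalPhysics.QuantumFieldTheory.Balaban1983to89.BlockAxialRepresentative (axialize axializer axialize_def)
open _root_.Matrix _root_.Filter

/-! ## §1  At `SU(2)` fields in the guard the projected block IS gen 5's block; the projected Jacobian factor is gauge invariant on the torus; `↑(axialize V)` is a gauge transform of `↑V` -/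

section TorusFacts

variable {P : Params} {j : ℕ}

/-- ★ **AT `SU(2)` FIELDS IN THE GUARD, `jacBlockCt = jacBlockC`**: the componentwise derivative is the component of the total derivative (`avgMh` is differentiable there, `fderiv_apply`), and the
response is traceless (`trace_jacResponse_eq_zero`), so the trace projection does nothing. [cite: Balaban1987RG1, p.267–268; Balaban1985Variational, Prop. 9 p.309] -/
theorem jacBlockCt_coeField_eq_jacBlockC (V : GaugeField P j (SU 2)) (hs : ∀ c : PBond P (j + 1), Small expMeanLogSU V c) (c : PBond P (j + 1)) :
    jacBlockCt c (coeField V) = jacBlockC c (coeField V) := by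
  have hd : DifferentiableAt ℂ (avgMh : (PBond P j → MatA 2) → PBond P (j + 1) → MatA 2) (coeField V) := differentiableAt_avgMh_coeField hs
  have hW : ∀ b, (coeField V b).det = 1 := fun b => (Matrix.mem_specialUnitaryGroup_iff.1 (V b).2).2
  have hpoly : ∀ (c' : PBond P (j + 1)) (i : Idx P), ‖loopMh (coeField V) c' i - 1‖ < 1 / 3 := fun c' i => by
    rw [loopMh_coeField]; exact ExpMeanLog.lt_third_of_lt_deltaSU (norm_loopM_coeField_sub_one_lt V c' (hs c') i)
  ext i a
  simp only [jacBlockCt, jacBlockC, Matrix.of_apply]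
  have happ : fderiv ℂ (fun W' : PBond P j → MatA 2 => avgMh W' c) (coeField V) (Pi.single (centralBond c) (su2Gen a * coeField V (centralBond c))) =
      fderiv ℂ (avgMh : (PBond P j → MatA 2) → PBond P (j + 1) → MatA 2) (coeField V) (Pi.single (centralBond c) (su2Gen a * coeField V (centralBond c))) c := by
    rw [fderiv_apply hd c]; rfl
  rw [happ, su2CoordCt_of_trace_eq_zero (trace_jacResponse_eq_zero (coeField V) hW hpoly c a)]

/-- … hence `jacFactorCt = jacFactorC` there. [cite: Balaban1987RG1, p.268 (bookkeeping)] -/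
theorem jacFactorCt_coeField_eq_jacFactorC (V : GaugeField P j (SU 2)) (hs : ∀ c : PBond P (j + 1), Small expMeanLogSU V c) (c : PBond P (j + 1)) :
    jacFactorCt c (coeField V) = jacFactorC c (coeField V) := by
  rw [jacFactorCt, jacFactorC, jacBlockCt_coeField_eq_jacBlockC V hs c]

/-- ★ **THE PROJECTED JACOBIAN FACTOR IS GAUGE INVARIANT ON THE TORUS** (level `j`, det-one matrix-valued `u`, EVERY `W`; the integer invariance read through the level-`j` cover).
[cite: Balaban1987RG1, (1.19) p.263, (2.16) p.269] -/
theorem jacFactorCt_gauge (hj : j + 1 ≤ P.m + P.K) (u : Site P j → MatA 2) (hu : ∀ x, (u x).det = 1) (W : PBond P j → MatA 2) (c : PBond P (j + 1)) :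
    jacFactorCt c (fun b : PBond P j => u b.src * W b * (u b.tgt).adjugate) = jacFactorCt c W := by
  have hL : 2 * ((P.L - 1) / 2) + 1 = P.L := AveragingRT.two_mul_half_add_one P
  rw [← coverBondAt_valLift c, jacFactorCt_coverBondAt hj, jacFactorCt_coverBondAt hj]
  have hcfg : (fun b : (Fin P.d → ℤ) × Fin P.d => (fun b' : PBond P j => u b'.src * W b' * (u b'.tgt).adjugate) (coverBondAt P j b)) =
      fun b => u (coverAt P j b.1) * W (coverBondAt P j b) * (u (coverAt P j (b.1 + e b.2))).adjugate := by
    funext b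
    show u (coverBondAt P j b).src * W (coverBondAt P j b) * (u (coverBondAt P j b).tgt).adjugate = _
    rw [coverBondAt_tgt]; rfl
  rw [hcfg]
  exact jacFactorZ_gauge hL (fun z => u (coverAt P j z)) (fun z => hu _) _ _

/-- **`↑(V^u)` is the det-one matrix gauge transform of `↑V`** for `SU(2)`-valued `u` (`↑(g⁻¹) = (↑g)⋆ = adj ↑g`). [cite: Balaban1985Averaging, (8) p.18 (bookkeeping)] -/
theorem coeField_gaugeAct (u : GaugeTransf P j (SU 2)) (V : GaugeField P j (SU 2)) :
    coeField (GaugeField.gaugeAct u V) = fun b : PBond P j => ((u b.src : SU 2) : MatA 2) * coeField V b * (((u b.tgt : SU 2) : MatA 2)).adjugate := by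
  funext b
  have hinv : (((u b.tgt)⁻¹ : SU 2) : MatA 2) = star ((u b.tgt : SU 2) : MatA 2) := rfl
  show (((u b.src * V b * (u b.tgt)⁻¹ : SU 2)) : MatA 2) = _
  push_cast
  rw [hinv, ← adjugate_coe_eq_star, coeField_apply]

end TorusFacts

/-! ## §2  Along the record's path near `B = 0`: the guard below `k` for `U_{k+1}(W_B)`; THE JACOBIAN FACTOR OF `phiLZjac` IS `J_T(c, ↑U_{k+1}(W_B))` -/

section Germ

variable (F : T4Family)

/-- **Near `B = 0` the rooted background is guarded below `k`**: `SmallBelow (avOfRecord F 2 K) k (U_{k+1}(W_B))` eventually (each `Ū^j(U_{k+1}(W_B)) → Ū^j(1) = 1`, and `1` is guarded).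
[cite: Balaban1987RG1, (0.4) p.253, (2.3) p.265; Balaban1985Variational, Prop. 9 p.309] -/
theorem eventually_smallBelow_recordBgField (θ : Stage13Params F 2) {k K : ℕ} (hk : k + 1 ≤ (F.P K).m + (F.P K).K)
    (hP9 : letI := θ.instVβ₁; letI := θ.instVβ₂
      AnalyticAt ℝ (fun B : Fin (F.P K).d → Site (F.P K) (k + 1) → θ.Vβ => fun (b : PBond (F.P K) 0) (i i' : Fin 2) =>
        ((recordBgField F θ k K B b : SU 2) : Matrix (Fin 2) (Fin 2) ℂ) i i') 0) :
    letI := θ.instVβ₁; letI := θ.instVβ₂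
    ∀ᶠ B in 𝓝 (0 : Fin (F.P K).d → Site (F.P K) (k + 1) → θ.Vβ), SmallBelow (avOfRecord F 2 K) k (recordBgField F θ k K B) := by
  letI := θ.instVβ₁; letI := θ.instVβ₂
  have hbg : ContinuousAt (fun B : Fin (F.P K).d → Site (F.P K) (k + 1) → θ.Vβ => recordBgField F θ k K B) 0 :=
    continuousAt_pi.2 fun b => (Topology.IsInducing.subtypeVal.continuousAt_iff).2 (continuousAt_recordBgField_of_analyticAt F θ k K hP9 b)
  have h0 : recordBgField F θ k K (0 : Fin (F.P K).d → Site (F.P K) (k + 1) → θ.Vβ) = 1 := recordBgField_zero F θ hk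
  have hj : ∀ j : Fin k, ∀ᶠ B in 𝓝 (0 : Fin (F.P K).d → Site (F.P K) (k + 1) → θ.Vβ),
      ∀ c : PBond (F.P K) ((j : ℕ) + 1), Small expMeanLogSU (Averaging.iter (avOfRecord F 2 K) j (recordBgField F θ k K B)) c := by
    intro j
    have hit : ContinuousAt (Averaging.iter (avOfRecord F 2 K) (j : ℕ)) (recordBgField F θ k K (0 : Fin (F.P K).d → Site (F.P K) (k + 1) → θ.Vβ)) := by
      rw [h0]; exact continuousAt_iter_avOfRecord_one F K j
    have hcont : ContinuousAt (fun B : Fin (F.P K).d → Site (F.P K) (k + 1) → θ.Vβ => Averaging.iter (avOfRecord F 2 K) (j : ℕ) (recordBgField F θ k K B)) 0 :=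
      hit.comp hbg
    have h1 : Averaging.iter (avOfRecord F 2 K) (j : ℕ) (recordBgField F θ k K (0 : Fin (F.P K).d → Site (F.P K) (k + 1) → θ.Vβ)) = 1 := by
      rw [h0]; exact B15Claim189UnitTestAtRecord.iter_avOfRecord_one F 2 K j
    have hopen := eventually_small_nhds F (j : ℕ) K (V₀ := (1 : GaugeField (F.P K) (j : ℕ) (SU 2))) fun c => T3DescentFibreTower.small_one _ c
    rw [← h1] at hopen
    exact hcont.eventually hopen
  have hall := Filter.eventually_all.2 hj
  filter_upwards [hall] with B hB j hjk c
  exact hB ⟨j, hjk⟩ c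

/-- ★★★ **NEAR `B = 0`, THE JACOBIAN FACTOR OF `phiLZjac` IS THE TORUS JACOBIAN FUNCTIONAL OF THE ROOTED BACKGROUND**: under ⁸'s TokE + TokP9-reg shapes, eventually in `B`, for every coarse bond
`c`, `↑(jacFactor … B c) = J_T(c, ↑U_{k+1}(W_B))` — gen 5's `jacFactorC` at `↑V^{(k)}_{ax}(W_B)` (✓ `eventually_jacFactorC_portVkAx`) is the projected factor there (guard), `V^{(k)}_{ax}(W_B) =
axialize(Ū^k(U_{k+1}(W_B)))` (✓ `eventually_portVkAx_eq_axialize_iter`) is a gauge transform of `Ū^k(U_{k+1}(W_B))` (invariance), and `↑Ū^k = iterMh k ↑` under the guard below `k`.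
[cite: Balaban1987RG1, p.268, (2.3) p.265, (0.21) p.256; Balaban1985Variational, Thm 1 p.279, Prop. 9 p.309] -/
theorem eventually_jacFactor_eq_jacTorus (a₀ ε₂₉ : ℝ) {k K : ℕ} (hk : k + 1 ≤ (F.P K).m + (F.P K).K) {ε₁ : ℝ} (hε₁ : 0 < ε₁)
    (hTokE : ∀ V : GaugeField (F.P K) (k + 1) (SU 2), PlaqSmall ε₁ V → UkExists F 2 K (k + 1) a₀ V ∧ UniqueUkOrbit F 2 K (k + 1) a₀ V)
    (hP9 : letI θ := thetaFill F a₀ ε₂₉; letI := θ.instVβ₁; letI := θ.instVβ₂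
      AnalyticAt ℝ (fun B : recordW F a₀ ε₂₉ k K => fun (b : PBond (F.P K) 0) (i i' : Fin 2) =>
        ((recordBgField F θ k K B b : SU 2) : Matrix (Fin 2) (Fin 2) ℂ) i i') 0) :
    letI θ := thetaFill F a₀ ε₂₉; letI := θ.instVβ₁; letI := θ.instVβ₂
    ∀ᶠ B in 𝓝 (0 : recordW F a₀ ε₂₉ k K), ∀ c : PBond (F.P K) (k + 1),
      ((jacFactor F a₀ ε₂₉ k K B c : ℝ) : ℂ) = jacTorus k c (coeField (recordBgField F θ k K B)) := by
  letI θ := thetaFill F a₀ ε₂₉; letI := θ.instVβ₁; letI := θ.instVβ₂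
  filter_upwards [eventually_jacFactorC_portVkAx F a₀ ε₂₉ hk hε₁ hTokE hP9, eventually_small_portVkAx F a₀ ε₂₉ hk hε₁ hTokE hP9,
    eventually_portVkAx_eq_axialize_iter F a₀ ε₂₉ hk hε₁ hTokE, eventually_smallBelow_recordBgField F θ hk hP9] with B hJ hs hax hsb c
  have hdet : ∀ x, (((axializer (contourOfRecord F 2 K k) (Averaging.iter (avOfRecord F 2 K) k (recordBgField F θ k K B)) x : SU 2) : MatA 2)).det = 1 := fun x =>
    (Matrix.mem_specialUnitaryGroup_iff.1 (axializer (contourOfRecord F 2 K k) (Averaging.iter (avOfRecord F 2 K) k (recordBgField F θ k K B)) x).2).2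
  have hco : coeField (Averaging.iter (avOfRecord F 2 K) k (recordBgField F θ k K B)) = iterMh k (coeField (recordBgField F θ k K B)) :=
    coeField_avgFamily_eq_iterMh hsb
  rw [← (hJ c).2, ← jacFactorCt_coeField_eq_jacFactorC _ hs c, hax, axialize_def, coeField_gaugeAct,
    jacFactorCt_gauge hk (fun x => ((axializer (contourOfRecord F 2 K k) (Averaging.iter (avOfRecord F 2 K) k (recordBgField F θ k K B)) x : SU 2) : MatA 2)) hdet, hco]
  rfl

end Germ

/-! ## §3  ★★★ (f′)-W: THE WRAP-AWARE PAIR IDENTITY FOR `phiLZjac` -/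

section Represents

variable (F : T4Family)

variable {F} in
/-- The (1.9) pair of `U_{k+1}(W_B)` cut to `X` agrees with the uncut pair on the sites of `X` (bonds with both ends in `X` are bonds of `X`). [cite: Balaban1987RG1, (1.7)–(1.9) p.261 (bookkeeping)] -/
theorem agreeOnSet_pairCutTorusAt (a₀ ε₂₉ : ℝ) (Mc k K : ℕ) (X : (recordDomSys F Mc k K).Dom) (B : recordW F a₀ ε₂₉ k K) :
    letI θ := thetaFill F a₀ ε₂₉; letI := θ.instVβ₁; letI := θ.instVβ₂; letI := θ.instιβ
    Sect2.agreeOnSet (Sect2.domSites (F.P K) Mc (k + 1) X)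
      ((coeField (recordBgField F θ k K B), recordCurrent F θ k K B) : Sect2.CPair (F.P K) (MatA 2)) (pairCutTorusAt F a₀ ε₂₉ Mc k K X B) := by
  classical
  intro b h1 h2
  have hb : b ∈ domBonds F Mc k K X := ⟨h1, h2⟩
  rw [pairCutTorusAt_eq]
  constructor
  · simp only [if_pos hb, coeField_apply]
  · simp only [if_pos hb]
    rfl

open scoped Classical in
/-- ★★★ **(f′)-W FOR THE δ-JACOBIAN BRACKET**: under ⁸'s TokE + TokP9-reg token shapes at the shifted volumes, `ΨjacRaw F Mc k` and the torus pieces `jacTorusPieces F Mc k` REPRESENT `phiLZjac` near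
`B = 0` — `phiLZjac n B = Σ_X (X ∈ wrap ? E_T(X, pair cut to X) : Ψ_jac(X̂)(pulled-back pair cut to X))` eventually (the germ §2, the fibre decomposition `Σ_c = Σ_X Σ_{X(c) = X}`, locality of
`E_T` and the off-wrap identification `Ψ_jac(X̂)(φ ∘ π) = E_T(X, φ)`). [cite: Balaban1987RG1, (1.6)–(1.9) p.261, (1.21) p.264, p.268] -/
theorem representsW_phiLZjac {Mc : ℕ} (hMc : McGuard F Mc) (a₀ ε₂₉ : ℝ) (k : ℕ) {ε₁ : ℝ} (hε₁ : 0 < ε₁)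
    (hTokE : ∀ (n : ℕ) (V : GaugeField (F.P (recordK₀ F Mc k + n)) (k + 1) (SU 2)), PlaqSmall ε₁ V →
      UkExists F 2 (recordK₀ F Mc k + n) (k + 1) a₀ V ∧ UniqueUkOrbit F 2 (recordK₀ F Mc k + n) (k + 1) a₀ V)
    (hP9 : ∀ n : ℕ, letI θ := thetaFill F a₀ ε₂₉; letI := θ.instVβ₁; letI := θ.instVβ₂
      AnalyticAt ℝ (fun B : recordW F a₀ ε₂₉ k (recordK₀ F Mc k + n) => fun (b : PBond (F.P (recordK₀ F Mc k + n)) 0) (i i' : Fin 2) =>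
        ((recordBgField F θ k (recordK₀ F Mc k + n) B b : SU 2) : Matrix (Fin 2) (Fin 2) ℂ) i i') 0) :
    (ΨjacRaw F Mc k).RepresentsW F a₀ ε₂₉ Mc k (jacTorusPieces F Mc k) (phiLZjac F Mc a₀ ε₂₉ k) := by
  intro n
  letI θ := thetaFill F a₀ ε₂₉; letI := θ.instVβ₁; letI := θ.instVβ₂; letI := θ.instιβ
  have hk := succ_le_m_add_K_recordK₀ F Mc k n
  have hK : recordK₀ F Mc k ≤ recordK₀ F Mc k + n := Nat.le_add_right _ n
  have hgerm := eventually_jacFactor_eq_jacTorus F a₀ ε₂₉ hk hε₁ (hTokE n) (hP9 n)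
  have h0 : ∀ c : PBond (F.P (recordK₀ F Mc k + n)) (k + 1), ((jacFactor F a₀ ε₂₉ k (recordK₀ F Mc k + n) 0 c : ℝ) : ℂ) = jacTorus k c 1 := by
    intro c
    have h := hgerm.self_of_nhds c
    rw [recordBgField_zero F θ hk] at h
    rw [h]; rfl
  filter_upwards [hgerm] with B hB
  -- the pair of `U_{k+1}(W_B)` on the torus
  set φB : Sect2.CPair (F.P (recordK₀ F Mc k + n)) (MatA 2) := (coeField (recordBgField F θ k (recordK₀ F Mc k + n) B), recordCurrent F θ k (recordK₀ F Mc k + n) B) with hφB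
  -- Step 1: `phiLZjac n B = −Σ_c (J_T(c, ↑U_B) − J_T(c, 1)) = Σ_X E_T(X, φ_B)`
  have hsum : phiLZjac F Mc a₀ ε₂₉ k n B = ∑ X : (recordDomSys F Mc k (recordK₀ F Mc k + n)).Dom, jacPieceT F Mc k (recordK₀ F Mc k + n) X φB := by
    have e1 : phiLZjac F Mc a₀ ε₂₉ k n B = -∑ c : PBond (F.P (recordK₀ F Mc k + n)) (k + 1), (jacTorus k c φB.1 - jacTorus k c 1) := by
      unfold phiLZjac
      push_cast
      congr 1
      refine Finset.sum_congr rfl fun c _ => ?_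
      rw [hB c, h0 c]
    rw [e1, ← Finset.sum_fiberwise Finset.univ (fun c : PBond (F.P (recordK₀ F Mc k + n)) (k + 1) => domOfBond F Mc k (recordK₀ F Mc k + n) c)
      (fun c => jacTorus k c φB.1 - jacTorus k c 1), ← Finset.sum_neg_distrib]
    rfl
  rw [hsum]
  refine Finset.sum_congr rfl fun X _ => ?_
  -- Step 2: cut to `X` (locality), then read off/on the wrap class
  have hcut : jacPieceT F Mc k (recordK₀ F Mc k + n) X φB = jacPieceT F Mc k (recordK₀ F Mc k + n) X (pairCutTorusAt F a₀ ε₂₉ Mc k (recordK₀ F Mc k + n) X B) :=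
    jacPieceT_congr_of_agreeOnSet hMc hK X (agreeOnSet_pairCutTorusAt a₀ ε₂₉ Mc k _ X B)
  rw [hcut]
  split_ifs with hX
  · rfl
  · rw [pairCutAt_eq_pullPair_pairCutTorusAt, ΨjacRaw_intCubes_pullPair hMc hK hX]

end Represents

end Summit.QuantumFields.YangMills.Theorems.BalabanUVNodesPortS1

end
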